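import Summits.CriticalPhenomena.Ising3D.Control2DPolyCertAuto
import Summits.CriticalPhenomena.Ising3D.Control2DL11BoxITable
import Summits.CriticalPhenomena.Ising3D.Control2DL11BoxIData7
import Summits.CriticalPhenomena.Ising3D.Control2DUZn55c00a
import Summits.CriticalPhenomena.Ising3D.Control2DUZn55c00b
import Summits.CriticalPhenomena.Ising3D.Control2DUZn55c00c
import Summits.CriticalPhenomena.Ising3D.Control2DUZn55c00d
import Summits.CriticalPhenomena.Ising3D.Control2DUZn55c02a
import Summits.CriticalPhenomena.Ising3D.Control2DUZn55c02b
import Summits.CriticalPhenomena.Ising3D.Control2DUZn55c02c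
import Summits.CriticalPhenomena.Ising3D.Control2DUZn55c02d
import HarnessLib

/-!
# Kernel replay of the RB-2 certificate `j110211_functional_deriv2d_L11_E032_sig1o8_box0.89-0.9.json` (Λ = 11, E₀ = 32): Δ_ε ∉ [89/100, 9/10] at Δ_σ = 1/8 under A2D′: cell data, spins 2
(cell `pub-ising3x`, seat controls-1 gen 16; KERNEL PATH for the 2D γ-certificates, Λ = 11 — CONTROL-ONLY)

HONEST FRAMING: lottery ticket; floor = tightest certified 3D Ising CFT bounds; no exact-solution
claim without a proof. CONTROL-ONLY (`d = 2`, `Δ_σ = 1/8`; axiom set A2D′).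

Split layout (controls-1 g15): each spin's cell polynomial `cellPolyZ wtboxI slL11 11 ℓ Nd` is assembled in the kernel
from the table-independent one-sided literals `uZ Nd c k` (library files `Control2DUZn*`, `Control2DGammaL7U0n*e1005`)
into a literal `phat…` (`simp only` + `decide +kernel`); every Bernstein leaf `bernAuto phat q a L = true` (coefficients
computed in the kernel, `Control2DPolyCertAuto`) is its own kernel decision. This file is data + kernel decisions only; the cell theorems proper are assembled in `Control2DL11BoxICells`.
All integers come from the seat's exact mirror (HOME/code/controls/kp3: kmirror.py / gen_cert.py, cross-checked against
the independent rational twin twin.py) and are only CHECKED here. No facts, standard axioms only.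
-/

namespace Summit.CriticalPhenomena.Ising3D.Control2D

open Literature.MathematicalPhysics.QuantumFieldTheory.ConformalBootstrap3D

set_option maxHeartbeats 0 in
set_option maxRecDepth 200000 in
/-- **Kernel check of spin 2, leaf 4** (`y ∈ [534/256, 563/256]`, range C2; Bernstein coefficients of the coefficients truncated by `10^346`, computed in the kernel). [folklore] -/
theorem cellChk_boxI_s2l4 : bernAuto (ptrunc phatboxIs2 346) 256 534 29 = true := by
  decide +kernel

set_option maxHeartbeats 0 in
set_option maxRecDepth 200000 in
/-- **Kernel check of spin 2, leaf 5** (`y ∈ [563/256, 592/256]`, range C2; Bernstein coefficients of the coefficients truncated by `10^346`, computed in the kernel). [folklore] -/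
theorem cellChk_boxI_s2l5 : bernAuto (ptrunc phatboxIs2 346) 256 563 29 = true := by
  decide +kernel

set_option maxHeartbeats 0 in
set_option maxRecDepth 200000 in
/-- **Kernel check of spin 2, leaf 6** (`y ∈ [37/16, 66/16]`, range C2; Bernstein coefficients of the coefficients truncated by `10^346`, computed in the kernel). [folklore] -/
theorem cellChk_boxI_s2l6 : bernAuto (ptrunc phatboxIs2 346) 16 37 29 = true := by
  decide +kernel

set_option maxHeartbeats 0 in
set_option maxRecDepth 200000 in
/-- **Kernel check of spin 2, leaf 7** (`y ∈ [33/8, 62/8]`, range C2; Bernstein coefficients of the coefficients truncated by `10^346`, computed in the kernel). [folklore] -/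
theorem cellChk_boxI_s2l7 : bernAuto (ptrunc phatboxIs2 346) 8 33 29 = true := by
  decide +kernel

set_option maxHeartbeats 0 in
set_option maxRecDepth 200000 in
/-- **Kernel check of spin 2, leaf 8** (`y ∈ [31/4, 60/4]`, range C2; Bernstein coefficients of the coefficients truncated by `10^346`, computed in the kernel). [folklore] -/
theorem cellChk_boxI_s2l8 : bernAuto (ptrunc phatboxIs2 346) 4 31 29 = true := by
  decide +kernel

end Summit.CriticalPhenomena.Ising3D.Control2D
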